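import Summits.Ventures.Crystal3D.Bulk.CapBoxBernstein
import HarnessLib

/-!
# Bernstein forms on lists: de Casteljau halving, linearity and sign enclosures (generic, with proofs)

Venture `Crystal3D` (cell `pub-crystal3d`, phase 2; seat typer-bulk). Continuation of `CapBoxBernstein.lean`
(algorithms `castL` / `castR` / `lzip` are defined there):

* `bvF_castL : bvF (castL b) s = 2ⁿ · bvF b (s/2)` and `bvF_castR : bvF (castR b) s = 2ⁿ · bvF b ((1+s)/2)`
  — the scaled de Casteljau coefficients of the two halves ARE the Bernstein coefficients of the halves
  (closed form `L_a = 2ⁿ⁻ᵃ Σ_{l≤a} C(a,l) b_l`, binomial double sum, `castR` by reversal);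
* linearity of the value in the coefficient list (`bvF_lzip`, `bvF_map`) and the sign enclosures
  `le_bvF_of_forall` / `bvF_le_of_forall` (on `[0,1]` the value is a convex combination of the coefficients).

HONEST FRAMING: elementary bookkeeping [folklore: de Casteljau 1959 / subdivision of Bernstein forms];
nothing geometric is proved here.
-/

open Finset

namespace Summit.Ventures.Crystal3D.CapCut.Bern

variable {α : Type}

/-! ### De Casteljau halving -/

section Casteljau

variable {F : α → ℝ} {z : α} {add : α → α → α} {sc : ℕ → α → α}

/-- `F` reads `add` as `+`, `sc e` as multiplication by `2ᵉ`, and the default entry as `0`. [folklore] -/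
structure IsLin2 (F : α → ℝ) (z : α) (add : α → α → α) (sc : ℕ → α → α) : Prop where
  /-- default entry -/
  zero : F z = 0
  /-- additivity -/
  add : ∀ x y, F (add x y) = F x + F y
  /-- scaling by powers of two -/
  sc : ∀ (e : ℕ) (x : α), F (sc e x) = 2 ^ e * F x

/-- Length of `sumRow`. [folklore] -/
theorem sumRow_length (add : α → α → α) : ∀ l : List α, (sumRow add l).length = l.length - 1 := by
  intro l
  induction l with
  | nil => rfl
  | cons a tl ih =>
    cases tl with
    | nil => rfl
    | cons b tl' =>
      have h : sumRow add (a :: b :: tl') = add a b :: sumRow add (b :: tl') := rfl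
      rw [h, List.length_cons, ih]; simp

/-- Entries of `sumRow`. [folklore] -/
theorem sumRow_getD (add : α → α → α) (z : α) :
    ∀ (l : List α) (i : ℕ), i + 1 < l.length → (sumRow add l).getD i z = add (l.getD i z) (l.getD (i + 1) z) := by
  intro l
  induction l with
  | nil => intro i hi; simp at hi
  | cons a tl ih =>
    intro i hi
    cases tl with
    | nil => simp at hi
    | cons b tl' =>
      cases i with
      | zero => simp [sumRow]
      | succ i =>
        simp only [sumRow, List.getD_cons_succ]
        exact ih i (by simpa using hi)

/-- Iterated summed rows: entry `i` of `sumRow^[j] b` is `Σ_{l ≤ j} C(j,l) b_{i+l}` (through `F`). [folklore] -/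
theorem sumRow_iterate_getD (hF : IsLin2 F z add sc) :
    ∀ (j : ℕ) (b : List α) (i : ℕ), i + j < b.length →
      F (((sumRow add)^[j] b).getD i z) =
        ∑ l ∈ range (j + 1), (j.choose l : ℝ) * F (b.getD (i + l) z) := by
  intro j
  induction j with
  | zero => intro b i hi; simp
  | succ j ih =>
    intro b i hi
    rw [Function.iterate_succ_apply']
    have hlen : ((sumRow add)^[j] b).length = b.length - j := by
      clear hi ih
      induction j generalizing b with
      | zero => simp
      | succ j ih2 => rw [Function.iterate_succ_apply', sumRow_length, ih2]; omega
    rw [sumRow_getD add z _ i (by rw [hlen]; omega), hF.add, ih b i (by omega), ih b (i + 1) (by omega)]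
    -- Pascal
    symm
    rw [Finset.sum_range_succ' (fun l => ((j + 1).choose l : ℝ) * F (b.getD (i + l) z))]
    simp only [Nat.choose_zero_right, Nat.cast_one, one_mul, Nat.add_zero]
    have hsplit : ∑ l ∈ range (j + 1), ((j + 1).choose (l + 1) : ℝ) * F (b.getD (i + (l + 1)) z) =
        ∑ l ∈ range (j + 1), (j.choose l : ℝ) * F (b.getD (i + 1 + l) z) +
          ∑ l ∈ range (j + 1), (j.choose (l + 1) : ℝ) * F (b.getD (i + (l + 1)) z) := by
      rw [← Finset.sum_add_distrib]
      refine Finset.sum_congr rfl fun l _ => ?_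
      rw [Nat.choose_succ_succ', Nat.cast_add, show i + 1 + l = i + (l + 1) from by omega]; ring
    have hB : ∑ l ∈ range (j + 1), (j.choose (l + 1) : ℝ) * F (b.getD (i + (l + 1)) z) + F (b.getD i z) =
        ∑ l ∈ range (j + 1), (j.choose l : ℝ) * F (b.getD (i + l) z) := by
      rw [Finset.sum_range_succ' (fun l => (j.choose l : ℝ) * F (b.getD (i + l) z)), Finset.sum_range_succ]
      simp
    rw [hsplit, ← hB]; ring

/-- Entries of `castLAux`: entry `a` is `sc (e - a) ((sumRow^[a] row)[0])`. [folklore] -/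
theorem castLAux_getD (z : α) :
    ∀ (fuel e : ℕ) (row : List α) (a : ℕ), a < fuel → a < row.length →
      (castLAux add sc fuel e row).getD a z = sc (e - a) (((sumRow add)^[a] row).getD 0 z) := by
  intro fuel
  induction fuel with
  | zero => intro e row a ha; omega
  | succ fuel ih =>
    intro e row a ha hlen
    cases row with
    | nil => simp at hlen
    | cons r0 rest =>
      cases a with
      | zero => simp [castLAux]
      | succ a =>
        simp only [castLAux, List.getD_cons_succ]
        rw [ih (e - 1) _ a (by omega) (by rw [sumRow_length]; simp at hlen ⊢; omega)]
        rw [show e - 1 - a = e - (a + 1) from by omega, Function.iterate_succ_apply]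

/-- Length of `castLAux`. [folklore] -/
theorem castLAux_length : ∀ (fuel e : ℕ) (row : List α), fuel = row.length →
    (castLAux add sc fuel e row).length = row.length := by
  intro fuel
  induction fuel with
  | zero => intro e row h; cases row with | nil => rfl | cons _ _ => simp at h
  | succ fuel ih =>
    intro e row h
    cases row with
    | nil => simp at h
    | cons r0 rest =>
      simp only [castLAux, List.length_cons]
      rw [ih (e - 1) _ (by rw [sumRow_length]; simp at h ⊢; omega), sumRow_length]
      simp

/-- `castL` preserves length. [folklore] -/
theorem castL_length (b : List α) : (castL add sc b).length = b.length :=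
  castLAux_length _ _ _ rfl

/-- `castR` preserves length. [folklore] -/
theorem castR_length (b : List α) : (castR add sc b).length = b.length := by
  unfold castR; rw [List.length_reverse, castL_length, List.length_reverse]

/-- Entries of `castL` through `F`: `F(L_a) = 2ⁿ⁻ᵃ Σ_{l ≤ a} C(a,l) F(b_l)`. [folklore] -/
theorem castL_getD (hF : IsLin2 F z add sc) (n : ℕ) (b : List α) (hb : b.length = n + 1) (a : ℕ)
    (ha : a ≤ n) :
    F ((castL add sc b).getD a z) = 2 ^ (n - a) * ∑ l ∈ range (a + 1), (a.choose l : ℝ) * F (b.getD l z) := by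
  unfold castL
  rw [castLAux_getD z _ _ _ a (by omega) (by omega), hF.sc, hb, Nat.add_sub_cancel,
    sumRow_iterate_getD hF a b 0 (by omega)]
  simp only [Nat.zero_add]

/-- **Left halving is sound**: `bvF n (castL b) s = 2ⁿ · bvF n b (s/2)` (all real `s`). [folklore] -/
theorem bvF_castL (hF : IsLin2 F z add sc) (n : ℕ) (b : List α) (hb : b.length = n + 1) (s : ℝ) :
    bvF F z n (castL add sc b) s = 2 ^ n * bvF F z n b (s / 2) := by
  unfold bvF
  -- right-hand side: 2ⁿ C(n,l) (s/2)^l (1-s/2)^(n-l) = C(n,l) s^l (2-s)^(n-l)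
  have hR : 2 ^ n * ∑ l ∈ range (n + 1), bern n l (s / 2) * F (b.getD l z) =
      ∑ l ∈ range (n + 1), (n.choose l : ℝ) * s ^ l * (2 - s) ^ (n - l) * F (b.getD l z) := by
    rw [Finset.mul_sum]
    refine Finset.sum_congr rfl fun l hl => ?_
    have hl' : l ≤ n := by simpa [Nat.lt_succ_iff] using hl
    unfold bern
    have h2 : (2 : ℝ) ^ n = 2 ^ l * 2 ^ (n - l) := by rw [← pow_add]; congr 1; omega
    rw [h2]
    have e1 : (2 : ℝ) ^ l * (s / 2) ^ l = s ^ l := by rw [← mul_pow]; congr 1; ring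
    have e2 : (2 : ℝ) ^ (n - l) * (1 - s / 2) ^ (n - l) = (2 - s) ^ (n - l) := by rw [← mul_pow]; congr 1; ring
    calc 2 ^ l * 2 ^ (n - l) * ((n.choose l : ℝ) * (s / 2) ^ l * (1 - s / 2) ^ (n - l) * F (b.getD l z))
        = (n.choose l : ℝ) * (2 ^ l * (s / 2) ^ l) * (2 ^ (n - l) * (1 - s / 2) ^ (n - l)) * F (b.getD l z) := by
          ring
      _ = _ := by rw [e1, e2]
  rw [hR]
  -- left-hand side: expand entries, swap sums
  have hL : ∀ a ∈ range (n + 1), bern n a s * F ((castL add sc b).getD a z) =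
      ∑ l ∈ range (a + 1), bern n a s * 2 ^ (n - a) * (a.choose l : ℝ) * F (b.getD l z) := by
    intro a ha
    have ha' : a ≤ n := by simpa [Nat.lt_succ_iff] using ha
    rw [castL_getD hF n b hb a ha', Finset.mul_sum, Finset.mul_sum]
    refine Finset.sum_congr rfl fun l _ => ?_; ring
  rw [Finset.sum_congr rfl hL]
  -- swap: Σ_{a<n+1} Σ_{l<a+1} = Σ_{l<n+1} Σ_{a ∈ Ico l (n+1)}
  have hswap := Finset.sum_Ico_Ico_comm 0 (n + 1)
    (fun l a => bern n a s * 2 ^ (n - a) * (a.choose l : ℝ) * F (b.getD l z))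
  simp only [Finset.range_eq_Ico] at hswap ⊢
  rw [show (∑ a ∈ Ico 0 (n + 1), ∑ l ∈ Ico 0 (a + 1), bern n a s * 2 ^ (n - a) * (a.choose l : ℝ) * F (b.getD l z))
      = ∑ l ∈ Ico 0 (n + 1), ∑ a ∈ Ico l (n + 1), bern n a s * 2 ^ (n - a) * (a.choose l : ℝ) * F (b.getD l z)
      from hswap.symm]
  refine Finset.sum_congr rfl fun l hl => ?_
  have hl' : l ≤ n := by simp at hl; omega
  -- inner sum: Σ_{a=l}^{n} C(n,a) C(a,l) s^a (1-s)^(n-a) 2^(n-a) = C(n,l) s^l (2-s)^(n-l)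
  rw [← Finset.sum_mul]
  congr 1
  have hshift : ∑ a ∈ Ico l (n + 1), bern n a s * 2 ^ (n - a) * (a.choose l : ℝ) =
      ∑ j ∈ range (n - l + 1), bern n (l + j) s * 2 ^ (n - (l + j)) * ((l + j).choose l : ℝ) := by
    rw [Finset.sum_Ico_eq_sum_range, show n + 1 - l = n - l + 1 from by omega]
  rw [hshift]
  have hpow := add_pow s (2 - 2 * s) (n - l)
  rw [show s + (2 - 2 * s) = 2 - s by ring] at hpow
  rw [hpow, Finset.mul_sum]
  refine Finset.sum_congr rfl fun j hj => ?_
  have hj' : j ≤ n - l := by simpa [Nat.lt_succ_iff] using hj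
  unfold bern
  have hc : (n.choose (l + j) : ℝ) * ((l + j).choose l : ℝ) = (n.choose l : ℝ) * ((n - l).choose j : ℝ) := by
    have := Nat.choose_mul (n := n) (k := l + j) (s := l) (by omega)
    rw [show l + j - l = j from by omega] at this
    exact_mod_cast this
  have e3 : (2 - 2 * s) ^ (n - l - j) = 2 ^ (n - (l + j)) * (1 - s) ^ (n - (l + j)) := by
    rw [← mul_pow, show n - l - j = n - (l + j) from by omega]; ring
  rw [e3, pow_add]
  calc (n.choose (l + j) : ℝ) * (s ^ l * s ^ j) * (1 - s) ^ (n - (l + j)) * 2 ^ (n - (l + j)) * ((l + j).choose l : ℝ)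
      = ((n.choose (l + j) : ℝ) * ((l + j).choose l : ℝ)) * (s ^ l * s ^ j) * (1 - s) ^ (n - (l + j)) * 2 ^ (n - (l + j)) := by
        ring
    _ = ((n.choose l : ℝ) * ((n - l).choose j : ℝ)) * (s ^ l * s ^ j) * (1 - s) ^ (n - (l + j)) * 2 ^ (n - (l + j)) := by
        rw [hc]
    _ = (n.choose l : ℝ) * s ^ l * (s ^ j * (2 ^ (n - (l + j)) * (1 - s) ^ (n - (l + j))) * ((n - l).choose j : ℝ)) := by
        ring


/-- Entries of a reversed list. [folklore] -/
theorem getD_reverse' (l : List α) (a : ℕ) (d : α) (h : a < l.length) :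
    l.reverse.getD a d = l.getD (l.length - 1 - a) d := by
  rw [List.getD_eq_getElem?_getD, List.getElem?_reverse h, ← List.getD_eq_getElem?_getD]

/-- Entries of a mapped list (default mapped too). [folklore] -/
theorem getD_map' {β : Type} (f : β → α) : ∀ (l : List β) (n : ℕ) (d : β), (l.map f).getD n (f d) = f (l.getD n d) := by
  intro l
  induction l with
  | nil => intro n d; simp
  | cons x l ih => intro n d; cases n with
    | zero => simp
    | succ n => simp only [List.map_cons, List.getD_cons_succ, ih]

/-- Reversal reflects the parameter: `bvF n b.reverse s = bvF n b (1 - s)` for `b` of length `n + 1`.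
[folklore] -/
theorem bvF_reverse (F : α → ℝ) (z : α) (n : ℕ) (b : List α) (hb : b.length = n + 1) (s : ℝ) :
    bvF F z n b.reverse s = bvF F z n b (1 - s) := by
  unfold bvF
  rw [← Finset.sum_range_reflect (fun a => bern n a (1 - s) * F (b.getD a z)) (n + 1)]
  refine Finset.sum_congr rfl fun a ha => ?_
  have ha' : a ≤ n := by simpa [Nat.lt_succ_iff] using ha
  simp only [Nat.add_sub_cancel]
  have hget : b.reverse.getD a z = b.getD (n - a) z := by
    rw [getD_reverse' b a z (by omega), hb, Nat.add_sub_cancel]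
  rw [hget]
  unfold bern
  rw [Nat.choose_symm ha', show n - (n - a) = a from by omega, sub_sub_cancel]
  ring

/-- **Right halving is sound**: `bvF n (castR b) s = 2ⁿ · bvF n b ((1+s)/2)`. [folklore] -/
theorem bvF_castR (hF : IsLin2 F z add sc) (n : ℕ) (b : List α) (hb : b.length = n + 1) (s : ℝ) :
    bvF F z n (castR add sc b) s = 2 ^ n * bvF F z n b ((1 + s) / 2) := by
  unfold castR
  rw [bvF_reverse F z n _ (by rw [castL_length, List.length_reverse, hb]),
    bvF_castL hF n b.reverse (by rw [List.length_reverse, hb]), bvF_reverse F z n b hb]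
  congr 2; ring

end Casteljau

/-! ### Linearity in the coefficients and sign enclosures -/

/-- Additivity of the value under `lzip` (any lengths). [folklore] -/
theorem bvF_lzip {F : α → ℝ} {z : α} {add : α → α → α} (h0 : F z = 0)
    (hadd : ∀ x y, F (add x y) = F x + F y) (n : ℕ) (s : ℝ) :
    ∀ x y : List α, bvF F z n (lzip add x y) s = bvF F z n x s + bvF F z n y s := by
  have hget : ∀ (x y : List α) (a : ℕ), F ((lzip add x y).getD a z) = F (x.getD a z) + F (y.getD a z) := by
    intro x
    induction x with
    | nil => intro y a; simp [lzip, h0]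
    | cons c x ih =>
      intro y a
      cases y with
      | nil => simp [lzip, h0]
      | cons d y =>
        cases a with
        | zero => simp [lzip, hadd]
        | succ a => simp only [lzip, List.getD_cons_succ]; exact ih y a
  intro x y
  unfold bvF
  rw [← Finset.sum_add_distrib]
  refine Finset.sum_congr rfl fun a _ => ?_
  rw [hget]; ring

/-- Value of a mapped list: `bvF F (map g x) = c · bvF F' x` when `F ∘ g = c · F'` and `g z' = z`. [folklore] -/
theorem bvF_map {β : Type} {F : α → ℝ} {z : α} {F' : β → ℝ} {z' : β} (g : β → α) (c : ℝ)
    (hg : g z' = z) (hFg : ∀ x, F (g x) = c * F' x) (n : ℕ) (s : ℝ) (x : List β) :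
    bvF F z n (x.map g) s = c * bvF F' z' n x s := by
  unfold bvF
  rw [Finset.mul_sum]
  refine Finset.sum_congr rfl fun a _ => ?_
  rw [← hg, getD_map', hFg]; ring

/-- Lower enclosure: if every coefficient read through `F` is `≥ θ` (and the list has all `n+1` entries),
the value on `[0,1]` is `≥ θ`. [folklore] -/
theorem le_bvF_of_forall {F : α → ℝ} {z : α} (n : ℕ) (b : List α) (θ : ℝ)
    (h : ∀ a, a ≤ n → θ ≤ F (b.getD a z)) {s : ℝ} (h0 : 0 ≤ s) (h1 : s ≤ 1) : θ ≤ bvF F z n b s := by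
  unfold bvF
  calc θ = ∑ a ∈ range (n + 1), bern n a s * θ := by rw [← Finset.sum_mul, sum_bern, one_mul]
    _ ≤ _ := Finset.sum_le_sum fun a ha => by
        have ha' : a ≤ n := by simpa [Nat.lt_succ_iff] using ha
        exact mul_le_mul_of_nonneg_left (h a ha') (bern_nonneg n a h0 h1)

/-- Upper enclosure: if every coefficient read through `F` is `≤ θ`, the value on `[0,1]` is `≤ θ`.
[folklore] -/
theorem bvF_le_of_forall {F : α → ℝ} {z : α} (n : ℕ) (b : List α) (θ : ℝ)
    (h : ∀ a, a ≤ n → F (b.getD a z) ≤ θ) {s : ℝ} (h0 : 0 ≤ s) (h1 : s ≤ 1) : bvF F z n b s ≤ θ := by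
  unfold bvF
  calc _ ≤ ∑ a ∈ range (n + 1), bern n a s * θ := Finset.sum_le_sum fun a ha => by
        have ha' : a ≤ n := by simpa [Nat.lt_succ_iff] using ha
        exact mul_le_mul_of_nonneg_left (h a ha') (bern_nonneg n a h0 h1)
    _ = θ := by rw [← Finset.sum_mul, sum_bern, one_mul]

end Summit.Ventures.Crystal3D.CapCut.Bern
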